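import Literature.NumberTheory.LFunctions.WeissKernelLongSums
import Literature.NumberTheory.LFunctions.ClassGroupSieveDensity
import Literature.NumberTheory.LFunctions.DedekindZetaEntireConvexity
import Literature.NumberTheory.LFunctions.DedekindResidueCondQnLowerBound

/-!
# Bombieri's Lemme C for a number field: prime ideals are rare below a real zero of `ζ_K`

Topic `Literature/NumberTheory/LFunctions`, namespace `Literature.NumberTheory.LFunctions.NumberField`.
Everything here is PROVED (one definition with body, theorems; no named facts).

Let `K` be a number field of degree `n > 1` and suppose `ζ_K(β) = 0` for a real `β = 1 − δ` with
`3/4 ≤ β < 1` (an exceptional zero).  Then the prime ideals of `K` are RARE in the range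
`Q^{C₁} < N𝔭 ≤ x` as long as `δ log x ≤ 1` (`Q = |d_K| n^n`):

  `Σ_{y < N𝔭 ≤ x} N𝔭^{−β} ≤ 6 δ log x`   (`y ≥ Q^{C₁(n)}`, `y ≤ x`, `δ log x ≤ 1`)

(`sum_primes_rpow_le_of_dedekindZetaCont_eq_zero`; any finite set of prime ideals with norms in
`(y, x]`).  This is the number-field form of Bombieri's LEMME C ("si `L(β₁, χ₁) = 0` … la somme
`Σ (1 + χ₁(p))/p` est petite", *Le grand crible* §6, for `ζ(s)L(s, χ₁) = ζ_{ℚ(√d)}(s)`) and of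
Tao–Teräväinen's Proposition 3.5 (3.13); applied to the quadratic class field of a real class group
character it gives the rarity of the primes with `χ₁(𝔭) = 1` (`ClassGroupExceptionalPrimes.lean`), the
arithmetic input of the log-free zero-density estimate WITH the Deuring–Heilbronn factor `δ log T`
(Bombieri's Théorème 14, second assertion) for the class group `L`-functions of `K`.

Proof (Tao–Teräväinen's ratio device, at the exponent `β`, smoothed with Weiss's kernel): with
`G(u) = Σ_{𝔞} N𝔞^{−β} Φ(u − log N𝔞)` (`idealLongSum`; `Φ = longCutoff` of `WeissKernelLongSums.lean`),
unique factorisation of ideals gives `G(u₁ + v) ≥ G(u₁)(1 + Σ_{e^{u₁+w} < N𝔭 ≤ e^v} N𝔭^{−β})`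
(`idealLongSum_mul_one_add_sum_le`), while `ζ_K(β) = 0` makes `G(u) = κ_K Ψ̂(δ) e^{uδ}/δ + O(e^{−u/2})`
with NO constant term (`abs_idealLongSum_sub_le`, from `WeissKernel.norm_longSum_sub_le`); the ratio
is `e^{vδ} − 1 + (small) ≤ 3vδ` once `e^{u₁/2} ≫ |d_K|^{O(1)}/κ_K`, and `κ_K ≥ Q^{−A}`
(`ThornerZaman.exists_condQn_rpow_neg_le_residue`).

## References

* E. Bombieri, *Le grand crible dans la théorie analytique des nombres*, Astérisque 18 (1987), §6,
  Lemme C (pp. 48–52). [Bombieri1987GrandCrible]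
* T. Tao, J. Teräväinen, *The Hardy–Littlewood–Chowla conjecture in the presence of a Siegel zero*,
  J. London Math. Soc. 106 (2022), Proposition 3.5 (3.13) and its proof. [TaoTeravainen2021]
-/

noncomputable section

open Real Finset MeasureTheory Complex
open scoped NumberField

namespace Literature.NumberTheory.LFunctions.NumberField

open Literature.NumberTheory.LFunctions Literature.NumberTheory.LFunctions.WeissKernel

variable {K : Type*} [Field K] [NumberField K]

/-! ### The long sum over ideals -/

variable (K) in
/-- **`G(u) = Σ_{𝔞 ≠ 0} N𝔞^{−β} Φ_{m+1}(u − log N𝔞)`** (a finite sum: `Φ = 0` once `N𝔞 > e^{u + (m+1)/A}`).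
[cite: Bombieri1987GrandCrible, §6 Lemme C] -/
def idealLongSum (β A : ℝ) (m : ℕ) (u : ℝ) : ℝ :=
  ∑ I ∈ idealsNormLE K ⌊Real.exp (u + ((m : ℝ) + 1) / A)⌋₊,
    (Ideal.absNorm I : ℝ) ^ (-β) * longCutoff A m (u - Real.log (Ideal.absNorm I))

/-- Each term is nonnegative. [folklore] -/
theorem idealTerm_nonneg {A : ℝ} (hA : 0 < A) (β : ℝ) (m : ℕ) (u : ℝ) (I : Ideal (𝓞 K)) :
    0 ≤ (Ideal.absNorm I : ℝ) ^ (-β) * longCutoff A m (u - Real.log (Ideal.absNorm I)) :=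
  mul_nonneg (Real.rpow_nonneg (Nat.cast_nonneg _) _) (longCutoff_nonneg hA m _)

/-- `G(u) ≥ 0`. [folklore] -/
theorem idealLongSum_nonneg {A : ℝ} (hA : 0 < A) (β : ℝ) (m : ℕ) (u : ℝ) :
    0 ≤ idealLongSum K β A m u :=
  sum_nonneg fun I _ ↦ idealTerm_nonneg hA β m u I

/-- The cutoff vanishes beyond `N𝔞 > e^{u + (m+1)/A}`. [folklore] -/
theorem longCutoff_eq_zero_of_exp_lt {A : ℝ} (hA : 0 < A) (m : ℕ) (u : ℝ) {N : ℝ} (hN0 : 0 < N)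
    (hN : Real.exp (u + ((m : ℝ) + 1) / A) < N) : longCutoff A m (u - Real.log N) = 0 := by
  refine longCutoff_eq_zero hA m ?_
  have : u + ((m : ℝ) + 1) / A < Real.log N := by
    rw [Real.lt_log_iff_exp_lt hN0]; exact hN
  linarith

/-- The sum may be taken over any larger box of ideals. [folklore] -/
theorem idealLongSum_eq_sum_of_le {A : ℝ} (hA : 0 < A) (β : ℝ) (m : ℕ) (u : ℝ) {B : ℕ}
    (hB : ⌊Real.exp (u + ((m : ℝ) + 1) / A)⌋₊ ≤ B) :
    idealLongSum K β A m u = ∑ I ∈ idealsNormLE K B,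
      (Ideal.absNorm I : ℝ) ^ (-β) * longCutoff A m (u - Real.log (Ideal.absNorm I)) := by
  rw [idealLongSum]
  refine Finset.sum_subset (fun I hI ↦ ?_) (fun I hI hI' ↦ ?_)
  · rw [mem_idealsNormLE] at hI ⊢
    exact ⟨hI.1, hI.2.trans hB⟩
  · rw [mem_idealsNormLE] at hI hI'
    have hgt : ⌊Real.exp (u + ((m : ℝ) + 1) / A)⌋₊ < Ideal.absNorm I := by
      by_contra h; exact hI' ⟨hI.1, not_lt.mp h⟩
    have hN : Real.exp (u + ((m : ℝ) + 1) / A) < (Ideal.absNorm I : ℝ) := Nat.lt_of_floor_lt hgt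
    have hN0 : (0 : ℝ) < (Ideal.absNorm I : ℝ) := lt_trans (Real.exp_pos _) hN
    rw [longCutoff_eq_zero_of_exp_lt hA m u hN0 hN, mul_zero]

/-! ### Identification with the analytic long sum of `ζ_K` -/

/-- `(n : ℂ)^{−β} = ((n : ℝ)^{−β} : ℝ)`. [folklore] -/
theorem natCast_cpow_neg_ofReal (n : ℕ) (β : ℝ) :
    (n : ℂ) ^ (-(β : ℂ)) = (((n : ℝ) ^ (-β) : ℝ) : ℂ) := by
  rw [Complex.ofReal_cpow (Nat.cast_nonneg n)]
  push_cast
  rfl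

/-- **`G(u)` is the long sum of the Dirichlet series of `ζ_K`**:
`idealLongSum K β A m u = longSum (n ↦ a_n) β A m u`, `a_n = #{𝔞 : N𝔞 = n}` (group the ideals by
their norm; the cutoff kills `n > e^{u + (m+1)/A}`). [folklore] -/
theorem ofReal_idealLongSum_eq_longSum {A : ℝ} (hA : 0 < A) {β : ℝ} (hβ : β ≠ 0) (m : ℕ) (u : ℝ) :
    (idealLongSum K β A m u : ℂ) = longSum (fun n ↦ (idealNormCount K n : ℂ)) β A m u := by
  classical
  set w : ℝ := ((m : ℝ) + 1) / A with hw
  set B : ℕ := ⌊Real.exp (u + w)⌋₊ with hB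
  set τ : ℕ → ℂ := fun n ↦ (n : ℂ) ^ (-(β : ℂ)) * (longCutoff A m (u - Real.log n) : ℂ) with hτ
  -- the analytic side is a finite sum over `n ≤ B`
  have hzero : ∀ n ∉ Finset.range (B + 1), (idealNormCount K n : ℂ) * (n : ℂ) ^ (-(β : ℂ)) *
      (longCutoff A m (u - Real.log n) : ℂ) = 0 := by
    intro n hn
    rw [Finset.mem_range, not_lt] at hn
    have hn' : B < n := by omega
    have hN : Real.exp (u + w) < (n : ℝ) := Nat.lt_of_floor_lt hn'
    have hN0 : (0 : ℝ) < n := lt_trans (Real.exp_pos _) hN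
    rw [longCutoff_eq_zero_of_exp_lt hA m u hN0 hN]
    simp
  rw [longSum, tsum_eq_sum hzero]
  -- the ideal side, grouped by norm
  rw [idealLongSum]
  push_cast
  have hmaps : ∀ I ∈ idealsNormLE K B, Ideal.absNorm I ∈ Finset.range (B + 1) := by
    intro I hI
    rw [mem_idealsNormLE] at hI
    rw [Finset.mem_range]; omega
  rw [← Finset.sum_fiberwise_of_maps_to hmaps]
  refine Finset.sum_congr rfl fun n hn ↦ ?_
  -- the fibre over `n`
  have hfib : ∀ I ∈ (idealsNormLE K B).filter (fun I ↦ Ideal.absNorm I = n),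
      (((Ideal.absNorm I : ℝ) ^ (-β) : ℝ) : ℂ) * (longCutoff A m (u - Real.log (Ideal.absNorm I)) : ℂ) =
        τ n := by
    intro I hI
    rw [Finset.mem_filter] at hI
    rw [hI.2]
    simp only [hτ]
    rw [natCast_cpow_neg_ofReal]
  rw [Finset.sum_congr rfl hfib, Finset.sum_const, nsmul_eq_mul]
  rcases eq_or_ne n 0 with rfl | hn0
  · -- no nonzero ideal has norm `0`, and `0^{-β} = 0`
    have h0 : (0 : ℂ) ^ (-(β : ℂ)) = 0 :=
      Complex.zero_cpow (by rw [neg_ne_zero]; exact_mod_cast hβ)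
    simp [hτ, h0]
  · have hnB : n ≤ B := by rw [Finset.mem_range] at hn; omega
    rw [card_filter_idealsNormLE_absNorm_eq hn0 hnB, hτ]
    ring

/-! ### The asymptotic at a zero of `ζ_K` -/

/-- `Ψ̂(−δ)^{m+1}` is the real number `(sinh(δ/A)/(δ/A))^{m+1} ≥ 1`. [folklore] -/
theorem laplaceFactor_pow_neg_eq {A : ℝ} (m : ℕ) {δ : ℝ} (hδ : 0 < δ) :
    laplaceFactor A (-(δ : ℂ)) ^ (m + 1) = (((Real.sinh (δ / A) / (δ / A)) ^ (m + 1) : ℝ) : ℂ) := by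
  rw [laplaceFactor_neg, laplaceFactor_ofReal A hδ.ne']
  push_cast
  ring

/-- **`G(u) = κ_K ψ e^{uδ}/δ + O(|d_K| e^{−u/2})` at a zero `β = 1 − δ` of `ζ_K`** (`3/4 ≤ β < 1`,
`m ≥ n_K + 3`, `ψ = (sinh(δ/A)/(δ/A))^{m+1}`):
`|G(u) − κ_K ψ e^{uδ}/δ| ≤ 2 |d_K| e^{2n_K} C e^{−u/2}`, `C = majorConst A m (n_K + 1)`
(`WeissKernel.norm_longSum_sub_le` for `L(a, z) = ζ_K(z) = ζ₁_K(z)/(z − 1)`, `ζ₁_K(β) = 0`, and the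
uniform convexity bound `norm_dedekindZeta₁_le`). [cite: Bombieri1987GrandCrible, §6 Lemme C] -/
theorem abs_idealLongSum_sub_le {A : ℝ} (hA : 0 < A) {m : ℕ} (hm : Module.finrank ℚ K + 3 ≤ m)
    {β : ℝ} (hβ : 3 / 4 ≤ β) (hβ1 : β < 1) (hzero : dedekindZetaCont K β = 0) (u : ℝ) :
    |idealLongSum K β A m u - NumberField.dedekindZeta_residue K *
        (Real.sinh ((1 - β) / A) / ((1 - β) / A)) ^ (m + 1) * Real.exp (u * (1 - β)) / (1 - β)| ≤
      2 * (((NumberField.discr K).natAbs : ℝ) * Real.exp (2 * Module.finrank ℚ K)) *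
        majorConst A m (Module.finrank ℚ K + 1) * Real.exp (-(1 / 2 * u)) := by
  have hβ0 : β ≠ 0 := by linarith
  have hβ1' : (β : ℂ) ≠ 1 := by
    intro h; have := congrArg Complex.re h; simp at this; linarith
  set a : ℕ → ℂ := fun n ↦ (idealNormCount K n : ℂ) with ha
  have hsum : LSeriesSummable a ((β + 1 / 2 : ℝ) : ℂ) :=
    LSeriesSummable_dedekindZeta (K := K) (by simp; linarith)
  have hLF : ∀ z : ℂ, 1 < z.re → LSeries a z = dedekindZeta₁ K z / (z - 1) := by
    intro z hz
    have hz1 : z ≠ 1 := fun h ↦ by rw [h, Complex.one_re] at hz; exact lt_irrefl _ hz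
    rw [ha, ← dedekindZeta_eq_LSeries, dedekindZeta₁_apply_eq_mul hz]
    field_simp [sub_ne_zero.mpr hz1]
  have hFβ : dedekindZeta₁ K β = 0 := by
    rw [dedekindZeta₁_apply_of_ne_one hβ1', hzero, mul_zero]
  have hM : (0 : ℝ) ≤ ((NumberField.discr K).natAbs : ℝ) * Real.exp (2 * Module.finrank ℚ K) := by
    positivity
  have h := norm_longSum_sub_le hA (N := Module.finrank ℚ K + 1) (by omega) hβ hβ1 hsum
    (dedekindZeta₁_differentiable K) hLF hFβ hM (fun z hz ↦ norm_dedekindZeta₁_le K hz) u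
  rw [← ofReal_idealLongSum_eq_longSum hA hβ0, dedekindZeta₁_apply_one K,
    laplaceFactor_pow_neg_eq m (by linarith : 0 < 1 - β)] at h
  have e : ((NumberField.dedekindZeta_residue K : ℝ) : ℂ) *
      ((((Real.sinh ((1 - β) / A) / ((1 - β) / A)) ^ (m + 1) : ℝ) : ℂ)) *
        Complex.exp (u * (1 - β)) / ((1 - β : ℝ) : ℂ) =
      ((NumberField.dedekindZeta_residue K *
        (Real.sinh ((1 - β) / A) / ((1 - β) / A)) ^ (m + 1) * Real.exp (u * (1 - β)) / (1 - β) : ℝ) : ℂ) := by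
    push_cast
    rfl
  rw [e, ← Complex.ofReal_sub, Complex.norm_real, Real.norm_eq_abs] at h
  exact h

/-! ### The ratio device: unique factorisation of ideals -/

/-- A prime ideal of norm exceeding the norm of `I` does not divide `I`. [folklore] -/
theorem not_dvd_ideal_of_absNorm_lt {P I : Ideal (𝓞 K)} (hI : I ≠ ⊥)
    (hlt : Ideal.absNorm I < Ideal.absNorm P) : ¬ P ∣ I := by
  intro h
  have hle : I ≤ P := Ideal.le_of_dvd h
  have hdvd : Ideal.absNorm P ∣ Ideal.absNorm I := Ideal.absNorm_dvd_absNorm_of_le hle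
  have hpos : 0 < Ideal.absNorm I := Nat.pos_of_ne_zero (by rwa [Ne, Ideal.absNorm_eq_zero_iff])
  exact absurd (Nat.le_of_dvd hpos hdvd) (not_le.mpr hlt)

/-- **The ratio inequality** `G(u₁)(1 + Σ_{𝔭 ∈ Ps} N𝔭^{−β}) ≤ G(u₁ + v)` for any finite set `Ps` of
prime ideals with `e^{u₁ + (m+1)/A} < N𝔭 ≤ e^{v}`: the products `𝔞𝔭` (`𝔞` in the support of `G(u₁)`)
are pairwise distinct (unique factorisation: `𝔭` is the only prime factor of norm `> e^{u₁+w}`), lie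
outside that support, `N(𝔞𝔭)^{−β} = N𝔞^{−β} N𝔭^{−β}`, and `Φ(u₁ + v − log N𝔞 − log N𝔭) ≥ Φ(u₁ − log N𝔞)`
as `Φ` is nondecreasing and `log N𝔭 ≤ v`.  (Tao–Teräväinen: "the non-negativity and multiplicativity
of `1 ∗ χ`".) [cite: TaoTeravainen2021, Proposition 3.5 (proof)] -/
theorem idealLongSum_mul_one_add_sum_le {A : ℝ} (hA : 0 < A) (m : ℕ) (β : ℝ)
    (u₁ : ℝ) {v : ℝ} (hv : 0 ≤ v) (Ps : Finset (Ideal (𝓞 K)))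
    (hPs : ∀ P ∈ Ps, P.IsPrime ∧ Real.exp (u₁ + ((m : ℝ) + 1) / A) < (Ideal.absNorm P : ℝ) ∧
      (Ideal.absNorm P : ℝ) ≤ Real.exp v) :
    idealLongSum K β A m u₁ * (1 + ∑ P ∈ Ps, (Ideal.absNorm P : ℝ) ^ (-β)) ≤
      idealLongSum K β A m (u₁ + v) := by
  classical
  set w : ℝ := ((m : ℝ) + 1) / A with hw
  set B₁ : ℕ := ⌊Real.exp (u₁ + w)⌋₊ with hB₁
  set B₂ : ℕ := ⌊Real.exp (u₁ + v + w)⌋₊ with hB₂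
  set S := idealsNormLE K B₁ with hS
  set T := idealsNormLE K B₂ with hT
  set t₁ : Ideal (𝓞 K) → ℝ := fun I ↦
    (Ideal.absNorm I : ℝ) ^ (-β) * longCutoff A m (u₁ - Real.log (Ideal.absNorm I)) with ht₁
  set t₂ : Ideal (𝓞 K) → ℝ := fun I ↦
    (Ideal.absNorm I : ℝ) ^ (-β) * longCutoff A m (u₁ + v - Real.log (Ideal.absNorm I)) with ht₂
  have ht₂0 : ∀ I, 0 ≤ t₂ I := fun I ↦ idealTerm_nonneg hA β m (u₁ + v) I
  have hG₁ : idealLongSum K β A m u₁ = ∑ I ∈ S, t₁ I := rfl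
  have hG₂ : idealLongSum K β A m (u₁ + v) = ∑ I ∈ T, t₂ I := rfl
  -- basic facts on `S` and `Ps`
  have hB₁le : (B₁ : ℝ) ≤ Real.exp (u₁ + w) := Nat.floor_le (Real.exp_pos _).le
  have hSmem : ∀ I ∈ S, I ≠ ⊥ ∧ (Ideal.absNorm I : ℝ) ≤ Real.exp (u₁ + w) := by
    intro I hI
    rw [hS, mem_idealsNormLE] at hI
    exact ⟨hI.1, le_trans (by exact_mod_cast hI.2) hB₁le⟩
  have hPfacts : ∀ P ∈ Ps, P.IsPrime ∧ P ≠ ⊥ ∧ Real.exp (u₁ + w) < (Ideal.absNorm P : ℝ) ∧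
      (Ideal.absNorm P : ℝ) ≤ Real.exp v := by
    intro P hP
    obtain ⟨h1, h2, h3⟩ := hPs P hP
    refine ⟨h1, ?_, h2, h3⟩
    rintro rfl
    rw [Ideal.absNorm_bot, Nat.cast_zero] at h2
    exact absurd h2 (not_lt.mpr (Real.exp_pos _).le)
  -- the product map and its image
  set f : Ideal (𝓞 K) × Ideal (𝓞 K) → Ideal (𝓞 K) := fun q ↦ q.1 * q.2 with hf
  set Im := (S ×ˢ Ps).image f with hIm
  -- (iv) injectivity
  have hinj : Set.InjOn f ↑(S ×ˢ Ps) := by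
    rintro ⟨I, P⟩ hq ⟨I', P'⟩ hq' heq
    simp only [Finset.coe_product, Set.mem_prod, Finset.mem_coe] at hq hq'
    obtain ⟨hIne, hIle⟩ := hSmem I hq.1
    obtain ⟨hI'ne, hI'le⟩ := hSmem I' hq'.1
    obtain ⟨hPpr, hPne, hPgt, -⟩ := hPfacts P hq.2
    obtain ⟨hP'pr, hP'ne, hP'gt, -⟩ := hPfacts P' hq'.2
    simp only [hf] at heq
    have hprime : Prime P := Ideal.prime_of_isPrime hPne hPpr
    have hdvd : P ∣ I' * P' := by rw [← heq]; exact Dvd.intro_left I rfl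
    rcases hprime.dvd_or_dvd hdvd with h | h
    · exfalso
      refine not_dvd_ideal_of_absNorm_lt hI'ne ?_ h
      exact_mod_cast (lt_of_le_of_lt hI'le hPgt)
    · have hle : P' ≤ P := Ideal.le_of_dvd h
      have hmax : P'.IsMaximal := Ideal.IsPrime.isMaximal hP'pr hP'ne
      have hPP : P' = P := hmax.eq_of_le hPpr.ne_top hle
      subst hPP
      have hI : I = I' := mul_right_cancel₀ (show P' ≠ 0 from hPne) heq
      subst hI
      rfl
  -- (iii) the image misses `S`
  have hdisj : Disjoint S Im := by
    rw [Finset.disjoint_left]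
    intro J hJS hJIm
    rw [hIm, Finset.mem_image] at hJIm
    obtain ⟨⟨I, P⟩, hq, hJ⟩ := hJIm
    rw [Finset.mem_product] at hq
    obtain ⟨hIne, -⟩ := hSmem I hq.1
    obtain ⟨-, hPne, hPgt, -⟩ := hPfacts P hq.2
    obtain ⟨-, hJle⟩ := hSmem J hJS
    simp only [hf] at hJ
    rw [← hJ, map_mul Ideal.absNorm, Nat.cast_mul] at hJle
    have hI1 : (1 : ℝ) ≤ (Ideal.absNorm I : ℝ) := by
      have : Ideal.absNorm I ≠ 0 := by rwa [Ne, Ideal.absNorm_eq_zero_iff]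
      exact_mod_cast Nat.one_le_iff_ne_zero.mpr this
    have : (Ideal.absNorm P : ℝ) ≤ (Ideal.absNorm I : ℝ) * (Ideal.absNorm P : ℝ) := by
      nlinarith [Nat.cast_nonneg (α := ℝ) (Ideal.absNorm P)]
    linarith
  -- (ii) the image lies in `T`, and (i) `S ⊆ T`
  have hB₁B₂ : B₁ ≤ B₂ := by
    rw [hB₁, hB₂]
    exact Nat.floor_le_floor (Real.exp_le_exp.mpr (by linarith))
  have hST : S ⊆ T := by
    intro I hI
    rw [hS, mem_idealsNormLE] at hI
    rw [hT, mem_idealsNormLE]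
    exact ⟨hI.1, hI.2.trans hB₁B₂⟩
  have hImT : Im ⊆ T := by
    intro J hJ
    rw [hIm, Finset.mem_image] at hJ
    obtain ⟨⟨I, P⟩, hq, hJ⟩ := hJ
    rw [Finset.mem_product] at hq
    obtain ⟨hIne, hIle⟩ := hSmem I hq.1
    obtain ⟨-, hPne, -, hPle⟩ := hPfacts P hq.2
    simp only [hf] at hJ
    rw [hT, mem_idealsNormLE, ← hJ]
    refine ⟨mul_ne_zero hIne hPne, ?_⟩
    refine Nat.le_floor ?_
    rw [map_mul Ideal.absNorm, Nat.cast_mul, show u₁ + v + w = (u₁ + w) + v by ring, Real.exp_add]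
    exact mul_le_mul hIle hPle (Nat.cast_nonneg _) (Real.exp_pos _).le
  -- the comparison of terms
  have hmono : ∀ I ∈ S, t₁ I ≤ t₂ I := by
    intro I _
    simp only [ht₁, ht₂]
    refine mul_le_mul_of_nonneg_left (longCutoff_mono hA m (by linarith)) (Real.rpow_nonneg (Nat.cast_nonneg _) _)
  have hprod : ∀ I ∈ S, ∀ P ∈ Ps, t₁ I * (Ideal.absNorm P : ℝ) ^ (-β) ≤ t₂ (f (I, P)) := by
    intro I hI P hP
    obtain ⟨hIne, -⟩ := hSmem I hI
    obtain ⟨-, hPne, hPgt, hPle⟩ := hPfacts P hP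
    have hNI : (0 : ℝ) < (Ideal.absNorm I : ℝ) := by
      have : Ideal.absNorm I ≠ 0 := by rwa [Ne, Ideal.absNorm_eq_zero_iff]
      exact_mod_cast Nat.pos_of_ne_zero this
    have hNP : (0 : ℝ) < (Ideal.absNorm P : ℝ) := lt_trans (Real.exp_pos _) hPgt
    simp only [ht₁, ht₂, hf, map_mul Ideal.absNorm, Nat.cast_mul]
    rw [Real.mul_rpow hNI.le hNP.le, Real.log_mul hNI.ne' hNP.ne']
    have hlogP : Real.log (Ideal.absNorm P : ℝ) ≤ v := by
      rw [Real.log_le_iff_le_exp hNP]; exact hPle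
    have hΦ : longCutoff A m (u₁ - Real.log (Ideal.absNorm I : ℝ)) ≤
        longCutoff A m (u₁ + v - (Real.log (Ideal.absNorm I : ℝ) + Real.log (Ideal.absNorm P : ℝ))) :=
      longCutoff_mono hA m (by linarith)
    have h1 : 0 ≤ (Ideal.absNorm I : ℝ) ^ (-β) := Real.rpow_nonneg hNI.le _
    have h2 : 0 ≤ (Ideal.absNorm P : ℝ) ^ (-β) := Real.rpow_nonneg hNP.le _
    calc (Ideal.absNorm I : ℝ) ^ (-β) * longCutoff A m (u₁ - Real.log (Ideal.absNorm I : ℝ)) *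
          (Ideal.absNorm P : ℝ) ^ (-β)
        = (Ideal.absNorm I : ℝ) ^ (-β) * (Ideal.absNorm P : ℝ) ^ (-β) *
          longCutoff A m (u₁ - Real.log (Ideal.absNorm I : ℝ)) := by ring
      _ ≤ (Ideal.absNorm I : ℝ) ^ (-β) * (Ideal.absNorm P : ℝ) ^ (-β) *
          longCutoff A m (u₁ + v - (Real.log (Ideal.absNorm I : ℝ) + Real.log (Ideal.absNorm P : ℝ))) :=
          mul_le_mul_of_nonneg_left hΦ (mul_nonneg h1 h2)
  -- assemble
  have hsum_image : ∑ J ∈ Im, t₂ J = ∑ q ∈ S ×ˢ Ps, t₂ (f q) := by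
    rw [hIm, Finset.sum_image hinj]
  calc idealLongSum K β A m u₁ * (1 + ∑ P ∈ Ps, (Ideal.absNorm P : ℝ) ^ (-β))
      = ∑ I ∈ S, t₁ I + (∑ I ∈ S, t₁ I) * (∑ P ∈ Ps, (Ideal.absNorm P : ℝ) ^ (-β)) := by
        rw [hG₁]; ring
    _ = ∑ I ∈ S, t₁ I + ∑ q ∈ S ×ˢ Ps, t₁ q.1 * (Ideal.absNorm q.2 : ℝ) ^ (-β) := by
        rw [Finset.sum_mul_sum, Finset.sum_product]
    _ ≤ ∑ I ∈ S, t₂ I + ∑ q ∈ S ×ˢ Ps, t₂ (f q) := by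
        refine add_le_add (Finset.sum_le_sum hmono) (Finset.sum_le_sum fun q hq ↦ ?_)
        rw [Finset.mem_product] at hq
        exact hprod q.1 hq.1 q.2 hq.2
    _ = ∑ J ∈ S ∪ Im, t₂ J := by rw [Finset.sum_union hdisj, hsum_image]
    _ ≤ ∑ J ∈ T, t₂ J :=
        Finset.sum_le_sum_of_subset_of_nonneg (Finset.union_subset hST hImT) fun J _ _ ↦ ht₂0 J
    _ = idealLongSum K β A m (u₁ + v) := hG₂.symm

/-! ### Numerics of the ratio -/

/-- **The ratio bound**: if `G₁(1 + P) ≤ G₂`, `|G₁ − m₁| ≤ R`, `|G₂ − m₁ e^{vδ}| ≤ R`, `m₁ > 0`,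
`R ≤ m₁ δ v/2`, `0 ≤ v`, `δ v ≤ 1`, `P ≥ 0`, then `P ≤ 6 δ v`. [cite: TaoTeravainen2021, Proposition 3.5 (proof)] -/
theorem ratio_le_six_mul {G₁ G₂ m₁ R P δ v : ℝ} (hδ : 0 < δ) (hv : 0 ≤ v) (hδv : δ * v ≤ 1)
    (hm₁ : 0 < m₁) (h₁ : |G₁ - m₁| ≤ R) (h₂ : |G₂ - m₁ * Real.exp (v * δ)| ≤ R)
    (hR : R ≤ m₁ * δ * v / 2) (hP : 0 ≤ P) (hratio : G₁ * (1 + P) ≤ G₂) : P ≤ 6 * δ * v := by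
  have hG₁ : m₁ - R ≤ G₁ := by linarith [(abs_le.mp h₁).1]
  have hG₂ : G₂ ≤ m₁ * Real.exp (v * δ) + R := by linarith [(abs_le.mp h₂).2]
  have hexp : Real.exp (v * δ) - 1 ≤ 2 * (v * δ) := by
    -- `e^x − 1 ≤ 2x` on `[0, 1]` (cf. `SquarefreeSums.exp_sub_one_le_two_mul`)
    have hx0 : 0 ≤ v * δ := by positivity
    have hx1 : v * δ ≤ 1 := by rw [mul_comm]; exact hδv
    have h := Real.abs_exp_sub_one_sub_id_le (show |v * δ| ≤ 1 by rw [abs_of_nonneg hx0]; exact hx1)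
    have h1 : Real.exp (v * δ) - 1 - v * δ ≤ (v * δ) ^ 2 := le_trans (le_abs_self _) h
    nlinarith
  have hG₁pos : m₁ / 2 ≤ G₁ := by
    have : m₁ * δ * v / 2 ≤ m₁ / 2 := by
      have : m₁ * (δ * v) ≤ m₁ * 1 := mul_le_mul_of_nonneg_left hδv hm₁.le
      linarith
    linarith
  have hkey : G₁ * P ≤ 3 * m₁ * δ * v := by
    have e1 : G₁ * P ≤ G₂ - G₁ := by linarith
    have e2 : G₂ - G₁ ≤ m₁ * (Real.exp (v * δ) - 1) + 2 * R := by linarith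
    have e3 : m₁ * (Real.exp (v * δ) - 1) ≤ m₁ * (2 * (v * δ)) := mul_le_mul_of_nonneg_left hexp hm₁.le
    linarith
  have h3 : P * (m₁ / 2) ≤ P * G₁ := mul_le_mul_of_nonneg_left hG₁pos hP
  have h4 : P * (m₁ / 2) ≤ (6 * δ * v) * (m₁ / 2) := by linarith
  exact le_of_mul_le_mul_right h4 (by linarith)

/-! ### Lemme C for `ζ_K`: thresholds -/

/-- `log 12 ≥ 2`. [folklore] -/
theorem two_le_log_twelve : (2 : ℝ) ≤ Real.log 12 := by
  rw [Real.le_log_iff_exp_le (by norm_num)]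
  have := Real.exp_one_lt_d9
  have h : Real.exp 2 = Real.exp 1 * Real.exp 1 := by rw [← Real.exp_add]; norm_num
  rw [h]; nlinarith [Real.exp_pos (1:ℝ)]

/-- The threshold arithmetic: with `C₁ = 2(A₀+1) + (log E + w/2 + 1)` and `Q ≥ 12`, `y ≥ Q^{C₁}`,
`x ≥ y`, the parameters `u₁ = log y − w`, `v = log x` satisfy `u₁ ≥ 0`, `v ≥ 1` and
`E Q^{A₀+1} ≤ e^{u₁/2}`. [folklore] -/
theorem threshold_aux {Q A₀ E w y x : ℝ} (hQ : 12 ≤ Q) (hA₀ : 0 ≤ A₀) (hE : 1 ≤ E) (hw : 0 < w)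
    (hy : Q ^ (2 * (A₀ + 1) + (Real.log E + w / 2 + 1)) ≤ y) (hyx : y ≤ x) :
    0 ≤ Real.log y - w ∧ 1 ≤ Real.log x ∧
      E * Q ^ (A₀ + 1) ≤ Real.exp (1 / 2 * (Real.log y - w)) := by
  set C₁ : ℝ := 2 * (A₀ + 1) + (Real.log E + w / 2 + 1) with hC₁
  have hQ1 : (1 : ℝ) < Q := by linarith
  have hQ0 : (0 : ℝ) < Q := by linarith
  have hlogQ : 2 ≤ Real.log Q := two_le_log_twelve.trans (Real.log_le_log (by norm_num) hQ)
  have hlogE : 0 ≤ Real.log E := Real.log_nonneg hE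
  have hy0 : 0 < y := lt_of_lt_of_le (Real.rpow_pos_of_pos hQ0 _) hy
  have hx0 : 0 < x := lt_of_lt_of_le hy0 hyx
  have hlogy : C₁ * Real.log Q ≤ Real.log y := by
    rw [Real.le_log_iff_exp_le hy0,
      show Real.exp (C₁ * Real.log Q) = Q ^ C₁ by rw [Real.rpow_def_of_pos hQ0, mul_comm]]
    exact hy
  have hlogx : Real.log y ≤ Real.log x := Real.log_le_log hy0 hyx
  have hC₁Q : 2 * (A₀ + 1) * Real.log Q + 2 * Real.log E + w + 2 ≤ C₁ * Real.log Q := by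
    have h2 : 0 ≤ Real.log E + w / 2 + 1 := by positivity
    have h3 := mul_le_mul_of_nonneg_left hlogQ h2
    have e : C₁ * Real.log Q = 2 * (A₀ + 1) * Real.log Q + (Real.log E + w / 2 + 1) * Real.log Q := by
      rw [hC₁]; ring
    rw [e]; linarith
  have hAQ : 0 ≤ 2 * (A₀ + 1) * Real.log Q := by positivity
  refine ⟨by linarith, by linarith, ?_⟩
  have hle : Real.log (E * Q ^ (A₀ + 1)) ≤ 1 / 2 * (Real.log y - w) := by
    rw [Real.log_mul (by linarith) (Real.rpow_pos_of_pos hQ0 _).ne', Real.log_rpow hQ0]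
    linarith
  calc E * Q ^ (A₀ + 1) = Real.exp (Real.log (E * Q ^ (A₀ + 1))) :=
        (Real.exp_log (by positivity)).symm
    _ ≤ Real.exp (1 / 2 * (Real.log y - w)) := Real.exp_le_exp.mpr hle

/-- The error is at most `κ/2`: `2 M C e^{−u₁/2} ≤ κ/2` when `M ≤ Q e^{2n}`, `κ ≥ Q^{−A₀}` and
`4 e^{2n} C Q^{A₀+1} ≤ e^{u₁/2}`. [folklore] -/
theorem error_le_half_aux {M C Q κ A₀ u₁ : ℝ} {n : ℕ} (hM : M ≤ Q * Real.exp (2 * n))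
    (hC : 0 < C) (hQ : 1 < Q) (hκ0 : 0 < κ) (hκ : Q ^ (-A₀) ≤ κ)
    (hu : 4 * Real.exp (2 * n) * C * Q ^ (A₀ + 1) ≤ Real.exp (1 / 2 * u₁)) :
    2 * M * C * Real.exp (-(1 / 2 * u₁)) ≤ κ / 2 := by
  have hQpos : 0 < Q := by linarith
  have hQA0 : Q ^ A₀ ≠ 0 := (Real.rpow_pos_of_pos hQpos A₀).ne'
  set E : ℝ := 4 * Real.exp (2 * n) * C with hE
  have h1 : E * Q = Q ^ (-A₀) * (E * Q ^ (A₀ + 1)) := by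
    rw [Real.rpow_add hQpos, Real.rpow_one, Real.rpow_neg hQpos.le]
    field_simp
  have h4MC : 4 * M * C ≤ E * Q := by
    rw [hE]
    have := mul_le_mul_of_nonneg_right hM hC.le
    nlinarith [hC, Real.exp_pos (2 * (n : ℝ))]
  have hEQ : E * Q ≤ κ * Real.exp (1 / 2 * u₁) := by
    rw [h1]
    exact mul_le_mul hκ hu (by positivity) hκ0.le
  have hpos : 0 < Real.exp (1 / 2 * u₁) := Real.exp_pos _
  have eR : 2 * M * C * Real.exp (-(1 / 2 * u₁)) = 2 * M * C / Real.exp (1 / 2 * u₁) := by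
    rw [Real.exp_neg, ← div_eq_mul_inv]
  rw [eR, div_le_iff₀ hpos]
  linarith

/-- The main term dominates: `κ/2 ≤ m₁ δ v / 2` for `m₁ = κ ψ e^{u₁δ}/δ`, `ψ ≥ 1`, `u₁ ≥ 0`, `v ≥ 1`.
[folklore] -/
theorem half_le_main_aux {κ ψ u₁ δ v : ℝ} (hκ : 0 < κ) (hψ : 1 ≤ ψ) (hu : 0 ≤ u₁) (hδ : 0 < δ)
    (hv : 1 ≤ v) : κ / 2 ≤ κ * ψ * Real.exp (u₁ * δ) / δ * δ * v / 2 := by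
  have hexp1 : 1 ≤ Real.exp (u₁ * δ) := Real.one_le_exp (by positivity)
  have h1 : κ * 1 * 1 ≤ κ * ψ * Real.exp (u₁ * δ) :=
    mul_le_mul (mul_le_mul_of_nonneg_left hψ hκ.le) hexp1 zero_le_one (by positivity)
  have e : κ * ψ * Real.exp (u₁ * δ) / δ * δ = κ * ψ * Real.exp (u₁ * δ) := by
    field_simp
  rw [e]
  have h2 : κ * ψ * Real.exp (u₁ * δ) ≤ κ * ψ * Real.exp (u₁ * δ) * v :=
    le_mul_of_one_le_right (by positivity) hv
  linarith

/-! ### Lemme C for `ζ_K` -/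

/-- **Bombieri's Lemme C for a number field (prime ideals are rare below a real zero of `ζ_K`).**
For every `n > 1` there is `C₁ > 0` such that for every number field `K` of degree `n`, every real
zero `β` of `ζ_K` with `3/4 ≤ β < 1`, all `x ≥ y ≥ Q^{C₁}` (`Q = |d_K| n^n`) with `(1 − β) log x ≤ 1`,
and every finite set `𝒫` of prime ideals of `K` with norms in `(y, x]`:
`Σ_{𝔭 ∈ 𝒫} N𝔭^{−β} ≤ 6 (1 − β) log x`.
[cite: Bombieri1987GrandCrible, §6 Lemme C] [cite: TaoTeravainen2021, Proposition 3.5 (3.13)] -/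
theorem sum_primes_rpow_le_of_dedekindZetaCont_eq_zero (n : ℕ) (hn : 1 < n) :
    ∃ C₁ : ℝ, 0 < C₁ ∧ ∀ (K : Type) [Field K] [NumberField K], Module.finrank ℚ K = n →
      ∀ β : ℝ, 3 / 4 ≤ β → β < 1 → dedekindZetaCont K β = 0 →
      ∀ x y : ℝ, ThornerZaman.condQn K ^ C₁ ≤ y → y ≤ x → (1 - β) * Real.log x ≤ 1 →
      ∀ Ps : Finset (Ideal (𝓞 K)),
        (∀ P ∈ Ps, P.IsPrime ∧ y < (Ideal.absNorm P : ℝ) ∧ (Ideal.absNorm P : ℝ) ≤ x) →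
        ∑ P ∈ Ps, (Ideal.absNorm P : ℝ) ^ (-β) ≤ 6 * (1 - β) * Real.log x := by
  obtain ⟨A₀, hA₀, hκ⟩ := ThornerZaman.exists_condQn_rpow_neg_le_residue n hn
  -- parameters of the kernel: `A = 1`, `m = n + 3`, `w = n + 4`
  set m : ℕ := n + 3 with hm
  set w : ℝ := ((m : ℝ) + 1) / 1 with hw
  set C : ℝ := majorConst 1 m (n + 1) with hC
  have hC0 : 0 < C := majorConst_pos 1 m (n + 1)
  set E : ℝ := 4 * Real.exp (2 * n) * C with hE
  have hC1 : 1 ≤ C := by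
    rw [hC, majorConst]
    have h1 : (1 : ℝ) ≤ Real.exp (3 * (m + 1) / (2 * 1)) := Real.one_le_exp (by positivity)
    have h2 : (1 : ℝ) ≤ (11 / 2 : ℝ) ^ (n + 1) := one_le_pow₀ (by norm_num)
    have h3 : (1 : ℝ) ≤ (1 + max 1 (1 : ℝ)) ^ (m + (n + 1) + 3) :=
      one_le_pow₀ (by have := le_max_left (1 : ℝ) 1; linarith)
    calc (1 : ℝ) ≤ 2 * 1 * 1 * 1 := by norm_num
      _ ≤ 2 * Real.exp (3 * (m + 1) / (2 * 1)) * (11 / 2 : ℝ) ^ (n + 1) *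
          (1 + max 1 (1 : ℝ)) ^ (m + (n + 1) + 3) := by gcongr
  have hE1 : 1 ≤ E := by
    rw [hE]
    have : (1 : ℝ) ≤ Real.exp (2 * n) := Real.one_le_exp (by positivity)
    nlinarith
  have hw0 : 0 < w := by rw [hw]; positivity
  set C₁ : ℝ := 2 * (A₀ + 1) + (Real.log E + w / 2 + 1) with hC₁
  have hC₁pos : 0 < C₁ := by
    have := Real.log_nonneg hE1
    rw [hC₁]; positivity
  refine ⟨C₁, hC₁pos, fun K _ _ hKn β hβ hβ1 hzero x y hy hyx hδx Ps hPs ↦ ?_⟩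
  have hK : 1 < Module.finrank ℚ K := by rw [hKn]; exact hn
  have hQ12 : (12 : ℝ) ≤ ThornerZaman.condQn K := ThornerZaman.twelve_le_condQn (K := K) hK
  have hQ1 : (1 : ℝ) < ThornerZaman.condQn K := by linarith
  obtain ⟨hu₁0, hv1, hexp_u⟩ := threshold_aux hQ12 hA₀ hE1 hw0 hy hyx
  have hy0 : 0 < y := lt_of_lt_of_le (Real.rpow_pos_of_pos (by linarith) _) hy
  have hx0 : 0 < x := lt_of_lt_of_le hy0 hyx
  have hδ0 : 0 < 1 - β := by linarith
  have hκ0 : 0 < _root_.NumberField.dedekindZeta_residue K := _root_.NumberField.dedekindZeta_residue_pos K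
  -- `u₁ = log y − w`, `v = log x`
  set u₁ : ℝ := Real.log y - w with hu₁
  set v : ℝ := Real.log x with hv
  have hv0 : 0 ≤ v := by linarith
  have hδv : (1 - β) * v ≤ 1 := hδx
  -- the primes lie in `(e^{u₁ + w}, e^{v}]`
  have hexpu : Real.exp (u₁ + ((m : ℝ) + 1) / 1) = y := by
    rw [show u₁ + ((m : ℝ) + 1) / 1 = Real.log y by rw [hu₁, hw]; ring, Real.exp_log hy0]
  have hexpv : Real.exp v = x := by rw [hv, Real.exp_log hx0]
  have hPs' : ∀ P ∈ Ps, P.IsPrime ∧ Real.exp (u₁ + ((m : ℝ) + 1) / 1) < (Ideal.absNorm P : ℝ) ∧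
      (Ideal.absNorm P : ℝ) ≤ Real.exp v := by
    intro P hP
    rw [hexpu, hexpv]
    exact hPs P hP
  have hratio := idealLongSum_mul_one_add_sum_le (K := K) one_pos m β u₁ hv0 Ps hPs'
  -- the two asymptotics
  have hmK : Module.finrank ℚ K + 3 ≤ m := by rw [hKn]
  set ψ : ℝ := (Real.sinh ((1 - β) / 1) / ((1 - β) / 1)) ^ (m + 1) with hψ
  have hψ1 : 1 ≤ ψ := one_le_pow₀ (one_le_sinh_div (by positivity))
  set M : ℝ := ((_root_.NumberField.discr K).natAbs : ℝ) * Real.exp (2 * Module.finrank ℚ K) with hMdef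
  have hCK : majorConst 1 m (Module.finrank ℚ K + 1) = C := by rw [hKn]
  have h₁ := abs_idealLongSum_sub_le (K := K) one_pos hmK hβ hβ1 hzero u₁
  have h₂ := abs_idealLongSum_sub_le (K := K) one_pos hmK hβ hβ1 hzero (u₁ + v)
  rw [hCK] at h₁ h₂
  set κ : ℝ := _root_.NumberField.dedekindZeta_residue K with hκdef
  set m₁ : ℝ := κ * ψ * Real.exp (u₁ * (1 - β)) / (1 - β) with hm₁
  have hm₁0 : 0 < m₁ := by rw [hm₁]; positivity
  set R : ℝ := 2 * M * C * Real.exp (-(1 / 2 * u₁)) with hRdef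
  have h₁' : |idealLongSum K β 1 m u₁ - m₁| ≤ R := h₁
  have h₂' : |idealLongSum K β 1 m (u₁ + v) - m₁ * Real.exp (v * (1 - β))| ≤ R := by
    have e : m₁ * Real.exp (v * (1 - β)) = κ * ψ * Real.exp ((u₁ + v) * (1 - β)) / (1 - β) := by
      rw [hm₁, show (u₁ + v) * (1 - β) = u₁ * (1 - β) + v * (1 - β) by ring, Real.exp_add]
      ring
    rw [e]
    refine h₂.trans ?_
    refine mul_le_mul_of_nonneg_left (Real.exp_le_exp.mpr (by linarith)) (by positivity)
  -- `R ≤ κ/2 ≤ m₁ δ v / 2`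
  have hMQ : M ≤ ThornerZaman.condQn K * Real.exp (2 * n) := by
    rw [hMdef, hKn]
    refine mul_le_mul_of_nonneg_right ?_ (Real.exp_pos _).le
    rw [Nat.cast_natAbs, Int.cast_abs]
    exact ThornerZaman.abs_discr_le_condQn K
  have hR : R ≤ m₁ * (1 - β) * v / 2 :=
    (error_le_half_aux hMQ hC0 hQ1 hκ0 (hκ K hKn) hexp_u).trans
      (half_le_main_aux hκ0 hψ1 hu₁0 hδ0 hv1)
  -- conclude
  have hP0 : 0 ≤ ∑ P ∈ Ps, (Ideal.absNorm P : ℝ) ^ (-β) :=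
    sum_nonneg fun P _ ↦ Real.rpow_nonneg (Nat.cast_nonneg _) _
  have := ratio_le_six_mul hδ0 hv0 hδv hm₁0 h₁' h₂' hR hP0 hratio
  linarith

end Literature.NumberTheory.LFunctions.NumberField

end
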